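import Summits.BirchSwinnertonDyer.BirchSwinnertonDyer.Theorems.AlignedTransportAtTwoBSDOfMainConjectureRankOneAtTwoEulerCharAtTwo
import Summits.BirchSwinnertonDyer.BirchSwinnertonDyer.Theorems.AlignedTransportAtTwoBSDOfMainConjectureRankOneAtTwoDisegniTight
import HarnessLib

/-!
# Route `AlignedTransportAtTwo`, crux C3′ `BSDOfMainConjectureRankOneAtTwo` (stmt-BirchSwinnertonDyer-23008), line `birth` v5 —
# the `Γ`-Euler characteristic at `2` ON THE CELL: `χ(Γ, Sel_{2^∞}(E/ℚ_∞))` is FINITE there (theorem, modulo GZK + modularity),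
# C3′ closes from its VALUE + four published facts, and per cell curve that value is EQUIVALENT to `BSD(W,2)`

HONEST FRAMING (cell `bsd-f1-sign2`, WIDTH-5 attach seat `bsd-line-att-p4` g6 under the C3′ lead lineage `bsd-line-att-p1`;
`--supports stmt-BirchSwinnertonDyer-23008 --as helper`). BSD is NOT proved; C3′ is NOT closed; nothing is asserted. THEOREMS ONLY
(no `def`, no named fact, no `sorry`). Companion of `…Theorems.AlignedTransportAtTwoEulerCharAtTwo` (the open stub
`F1Sign2.SchneiderLeadingTermFormulaAtTwoSq` ⟺ the `Γ`-Euler-characteristic formula at `2`).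

* §1 `exists_unit_padicLog_cyclotomicGenerator_two` — `log₂(γ_cyc) = log₂ 5 = 4·u`, `u ∈ ℤ₂ˣ` (the `2`-adic reading of CSS's `p^{-g}`);
  `order_eq_mordellWeilRank_iff_finite_coker_bockstein` — the coker form of the order-of-vanishing criterion (every good ordinary `p`).
* §2 `finite_bockstein_of_cell` — ON THE C3′ CELL (good ordinary at `2`, `r_an = 1`, simple zero of `L₂(f_E)`, `MazurMainConjecture W 2`),
  modulo Gross–Zagier–Kolyvagin and modularity ONLY: for every cyclotomic datum and every finitely generated strict-at-`∞` dual `X`,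
  `X` is `Λ`-torsion, every characteristic generator has `ord_T = 1 = rank E(ℚ)`, and **`ker φ_X` and `coker φ_X` are FINITE** — i.e.
  `χ(Γ, Sel_{2^∞}(E/ℚ_∞))` is DEFINED on the cell. So of the Euler-characteristic statement at `2` only its VALUE is open there.
* §3 `bsdOfMainConjectureRankOneAtTwo_of_eulerChar_of_disegni` — the crux BY NAME from the `Γ`-Euler-characteristic statement at `2`
  (global form) + Disegni 2020 Thm. 1 + GZK + modularity + Mazur–Tate `Σ²` (composition through p609883).
* §4 `eulerCharValueAt_iff_bsdp` — PER CELL CURVE, modulo the same four published facts and the crux binders: the VALUE statement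
  `#coker φ_X·(log₂ 5)^r·#E(ℚ)(2)² = u·#ker φ_X·Reg₂·#Ш(2)·2^{v₂(∏c_v)}·#Ẽ(𝔽₂)(2)²` (for every datum and THE `Σ²` height, given `Reg₂ ≠ 0`,
  `Ш(2)` finite) holds IF AND ONLY IF `BSDp W 2`. TIGHT: the re-pointed residual is exactly as strong as the crux's conclusion, curve by curve.

References: [CoatesSchneiderSujatha2003] §3 p. 199, p. 204; [Disegni2020] Thm. 1; [BalakrishnanMullerStein2015] Thm. 1.7 (3); [Miller2011LMS]
Def. 1.1; [GrossZagier1986]; [Kolyvagin1990]; [MazurTate1991] Thm. 3.1; [Iwasawa1972PadicL] §4.4.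
-/

set_option autoImplicit false
-- the route's Theorems namespace repeats a component by design (summit = sub-problem, D-0017).
set_option linter.dupNamespace false

noncomputable section

open scoped Classical MatrixGroups ModularForm

open CongruenceSubgroup WeierstrassCurve Literature.NumberTheory.EllipticCurves Literature.NumberTheory.EllipticCurves.IwasawaAlgebra
  Literature.NumberTheory.EllipticCurves.ModularForms Literature.NumberTheory.EllipticCurves.Greenberg1999
  Summit.BirchSwinnertonDyer.Rank1Residual.F1Sign2
  Summit.BirchSwinnertonDyer.BirchSwinnertonDyer.Theorems.Rank1ResidualX1Defs
  Summit.BirchSwinnertonDyer.BirchSwinnertonDyer.Theorems.AlignedTransportAtTwoOrderTransfer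
  Summit.BirchSwinnertonDyer.BirchSwinnertonDyer.Theorems.AlignedTransportAtTwoDisegni
  Summit.BirchSwinnertonDyer.BirchSwinnertonDyer.Theorems.AlignedTransportAtTwoDisegniTight
  Summit.BirchSwinnertonDyer.BirchSwinnertonDyer.Theorems.AlignedTransportAtTwoEulerCharAtTwo

namespace Summit.BirchSwinnertonDyer.BirchSwinnertonDyer.Theorems.AlignedTransportAtTwoEulerCharAtTwoCell

/-! ## §1 `log₂ 5 = 4·u`, and the coker form of the order criterion -/

/-- **`log₂(γ_cyc) = log₂ 5 = 4·u` with `u ∈ ℤ₂ˣ`** (`γ_cyc = cyclotomicGenerator 2 = 1 + 2² = 5`; `‖1 − 5‖₂ = ¼ < ‖2‖₂`, so the logarithm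
series is an isometry there: `‖log₂ 5‖ = ‖4‖`). The `p = 2` twin of `exists_unit_padicLog_cyclotomicGenerator` (`log_p(1+p) = p·u`, `p` odd):
CSS's normalisation `p^{-g}·R_p` of the `Γ`-Euler characteristic reads `4^{-r}·Reg₂` at `2`. [cite: Iwasawa1972PadicL, §4.4] -/
theorem exists_unit_padicLog_cyclotomicGenerator_two :
    ∃ u : ℤ_[2]ˣ, padicLog 2 (cyclotomicGenerator 2 : ℚ_[2]) = (4 : ℚ_[2]) * ((u : ℤ_[2]) : ℚ_[2]) := by
  have hγ : (cyclotomicGenerator 2 : ℚ_[2]) = 1 + 4 := by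
    rw [cyclotomicGenerator, cyclotomicExponent, if_pos rfl]; norm_num
  have h4 : (4 : ℚ_[2]) = (2 : ℚ_[2]) ^ 2 := by norm_num
  have hnorm2 : ‖(2 : ℚ_[2])‖ = 2⁻¹ := by
    have : ((2 : ℕ) : ℚ_[2]) = 2 := by norm_num
    rw [← this, Padic.norm_p]; norm_num
  have hnorm4 : ‖(4 : ℚ_[2])‖ = 4⁻¹ := by rw [h4, norm_pow, hnorm2]; norm_num
  have h40 : (4 : ℚ_[2]) ≠ 0 := norm_pos_iff.mp (by rw [hnorm4]; norm_num)
  have h1 : ‖1 - (1 + (4 : ℚ_[2]))‖ = ‖(4 : ℚ_[2])‖ := by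
    rw [show (1 : ℚ_[2]) - (1 + 4) = -4 by ring, norm_neg]
  have hlt1 : ‖1 - (1 + (4 : ℚ_[2]))‖ < 1 := by rw [h1, hnorm4]; norm_num
  have hlt2 : ‖1 - (1 + (4 : ℚ_[2]))‖ < ‖(2 : ℚ_[2])‖ := by rw [h1, hnorm4, hnorm2]; norm_num
  have hnorm : ‖padicLog 2 (1 + 4)‖ = ‖(4 : ℚ_[2])‖ := by
    rw [padicLog_eq_padicLogSeries hlt1, norm_padicLogSeries_eq hlt2, h1]
  obtain ⟨u, hu⟩ := exists_unit_coe_eq_of_norm_eq_one 2 (x := padicLog 2 (1 + 4) / 4) (by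
    rw [norm_div, hnorm, div_self (norm_ne_zero_iff.mpr h40)])
  refine ⟨u, ?_⟩
  rw [hγ, hu, mul_div_cancel₀ _ h40]

/-- Companion: under the same hypotheses `ord_{T=0} f_E = rank E(ℚ) ↔ coker φ_X` finite (`ker φ_X` finite `↔ coker φ_X` finite for a
finitely generated torsion `X`). [cite: CoatesSchneiderSujatha2003, §3 (30)–(31)] -/
theorem order_eq_mordellWeilRank_iff_finite_coker_bockstein (W : WeierstrassCurve ℚ) [W.IsElliptic] [W.IsGloballyMinimal]
    (p : ℕ) [Fact p.Prime] (hord : IsOrdinaryAt W p) {κ : ZpExtension ℚ p} {γ : Field.absoluteGaloisGroup ℚ}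
    (hκ : κ.IsCyclotomic) (hγ : κ.IsTopGenerator γ) (D : W.SelmerDualData κ γ) [Module.Finite (IwasawaAlgebra p) D.X]
    (hX : D.IsTorsion) (fE : IwasawaAlgebra p) (hchar : D.charIdeal = Ideal.span {fE})
    (hSha : Finite (AddCommGroup.primaryComponent W.sha p)) :
    fE.order = W.mordellWeilRank ↔ Finite (coinvariants p D.X ⧸ LinearMap.range (bockstein p D.X)) := by
  rw [order_eq_mordellWeilRank_iff_finite_ker_bockstein W p hord hκ hγ D hX fE hchar hSha,
    finite_ker_bockstein_iff_finite_coker_bockstein p D.X hX]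


/-! ## §2 On the C3′ cell `χ(Γ, Sel_{2^∞}(E/ℚ_∞))` is DEFINED: `ker φ_X`, `coker φ_X` finite (mod GZK + modularity) -/

/-- **`T`-semisimplicity of `X(E/ℚ_∞)` at `T = 0` on the C3′ cell (CONDITIONAL on GZK + modularity; closes nothing).** For `W` globally
minimal, good ordinary at `2`, of analytic rank one, with a simple zero of `L₂(f_E)` at `T = 0` for every conductor-level newform and
`MazurMainConjecture W 2` (the crux's binders), and for every cyclotomic datum `(κ, γ)` and every Pontryagin-dual datum `D` with `X = D.X`
finitely generated: `X` is `Λ`-torsion, every characteristic generator `f_E` has `ord_T f_E = rank E(ℚ) (= 1)`, and `ker φ_X`, `coker φ_X`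
are finite. Proof: modularity + the simple zero + MC give a generator of order `1` (`isTorsion_and_exists_charGenerator_order_eq_of_order_padicLFunction_eq`,
p591537); GZK gives `rank = 1` and `Ш` finite; then `order_eq_mordellWeilRank_iff_finite_ker_bockstein` (control at `2`). So on the cell the
`Γ`-Euler characteristic `#coker φ_X/#ker φ_X` is a well-defined positive rational; only its VALUE is open.
[cite: GreenbergLNM1716, Thm. 1.2] [cite: GrossZagier1986] [cite: Kolyvagin1990] [cite: CoatesSchneiderSujatha2003, §3 (30)–(31)] -/
theorem finite_bockstein_of_cell (hGZK : rank_eq_analyticRank_of_analyticRank_le_one) (hmod : nonempty_modularParametrizationData)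
    (W : WeierstrassCurve ℚ) [W.IsElliptic] [W.IsGloballyMinimal] (hord : IsOrdinaryAt W 2) (hr : W.analyticRank = 1)
    (hL : ∀ [NeZero (W.conductorNorm ℤ)] (f : CuspForm (Gamma0 (W.conductorNorm ℤ)) 2), IsNewformOf W f →
      (padicLFunction f (unitRoot W 2 : ℚ_[2])).order = 1)
    (hMC : MazurMainConjecture W 2) {κ : ZpExtension ℚ 2} {γ : Field.absoluteGaloisGroup ℚ}
    (hκ : κ.IsCyclotomic) (hγ : κ.IsTopGenerator γ) (hγ' : IsCyclotomicVariable 2 γ)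
    (D : W.SelmerDualData κ γ) [Module.Finite (IwasawaAlgebra 2) D.X] :
    D.IsTorsion ∧ (∀ fE : IwasawaAlgebra 2, D.charIdeal = Ideal.span {fE} → fE.order = W.mordellWeilRank) ∧
      Finite (LinearMap.ker (bockstein 2 D.X)) ∧ Finite (coinvariants 2 D.X ⧸ LinearMap.range (bockstein 2 D.X)) := by
  obtain ⟨hrank, hfinSha⟩ := hGZK W (le_of_eq hr)
  have hrank1 : W.mordellWeilRank = 1 := by rw [hrank, hr]
  haveI : Finite W.sha := hfinSha
  have hSha : Finite (AddCommGroup.primaryComponent W.sha 2) := inferInstance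
  obtain ⟨hX, g, hcharg, hordg⟩ :=
    isTorsion_and_exists_charGenerator_order_eq_of_order_padicLFunction_eq W 2 hmod hL hMC hκ hγ hγ' D
  -- every generator has the order of `g`
  have hgen : ∀ fE : IwasawaAlgebra 2, D.charIdeal = Ideal.span {fE} → fE.order = W.mordellWeilRank := by
    intro fE hchar
    have hspan : Ideal.span ({fE} : Set (IwasawaAlgebra 2)) = Ideal.span {g} := hchar.symm.trans hcharg
    obtain ⟨v, hv⟩ := Ideal.span_singleton_eq_span_singleton.mp hspan
    rw [hrank1, Nat.cast_one, ← hordg, ← hv, PowerSeries.order_mul, PowerSeries.order_zero_of_unit v.isUnit, add_zero]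
  have hfin : Finite (LinearMap.ker (bockstein 2 D.X)) :=
    (order_eq_mordellWeilRank_iff_finite_ker_bockstein W 2 hord hκ hγ D hX g hcharg hSha).mp (hgen g hcharg)
  exact ⟨hX, hgen, hfin, (finite_ker_bockstein_iff_finite_coker_bockstein 2 D.X hX).mp hfin⟩

/-! ## §3 The crux BY NAME from the `Γ`-Euler-characteristic statement at `2` + four published facts -/

/-- **C3′ from the `Γ`-Euler characteristic at `2` (CONDITIONAL; closes nothing).** Hypothesis `hχ` = the Euler-characteristic statement at `2`
in global form (right side of `…EulerCharAtTwo.schneiderLeadingTermFormulaAtTwoSq_iff_eulerChar`: for `W` good ordinary at `2`, every cyclotomic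
datum, every finitely generated torsion strict-at-`∞` dual `X`, THE `Σ²` height, given `Reg₂ ≠ 0` and `Ш(2)` finite: `ker φ_X` finite and
`#coker φ_X·(log₂ 5)^r·#E(ℚ)(2)² = u·#ker φ_X·Reg₂·#Ш(2)·2^{v₂(∏c_v)}·#Ẽ(𝔽₂)(2)²`) — NOT in print at `2` over `ℚ`; with Disegni 2020 Thm. 1, GZK,
modularity and Mazur–Tate `Σ²` at `2` this gives `BSDOfMainConjectureRankOneAtTwo` (through the equivalence and p609883 §3).
[cite: CoatesSchneiderSujatha2003, p. 204 (Case 2)] [cite: Disegni2020, Thm. 1] [cite: Miller2011LMS, Def. 1.1] -/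
theorem bsdOfMainConjectureRankOneAtTwo_of_eulerChar_of_disegni
    (hχ : ∀ (W : WeierstrassCurve ℚ) [W.IsElliptic] [W.IsGloballyMinimal],
      W.HasGoodReductionAtPrime 2 → ¬ (2 : ℤ) ∣ W.frobeniusTrace 2 →
      ∀ (κ : ZpExtension ℚ 2) (γ : Field.absoluteGaloisGroup ℚ),
        κ.IsCyclotomic → κ.IsTopGenerator γ → IsCyclotomicVariable 2 γ →
      ∀ (D : W.SelmerDualData κ γ) [Module.Finite (IwasawaAlgebra 2) D.X], D.IsTorsion →
      ∀ (Dh : PAdicHeightData W 2), Dh.IsCanonicalSq →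
        SchneiderConjecture Dh → Finite (AddCommGroup.primaryComponent W.sha 2) →
        Finite (LinearMap.ker (bockstein 2 D.X)) ∧
        ∃ u : ℤ_[2]ˣ,
          (Nat.card (coinvariants 2 D.X ⧸ LinearMap.range (bockstein 2 D.X)) : ℚ_[2]) *
              padicLog 2 (cyclotomicGenerator 2) ^ W.mordellWeilRank *
              (Nat.card (AddCommGroup.primaryComponent W.toAffine.Point 2) : ℚ_[2]) ^ 2 =
            ((u : ℤ_[2]) : ℚ_[2]) * Nat.card (LinearMap.ker (bockstein 2 D.X)) * padicRegulator Dh *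
              Nat.card (AddCommGroup.primaryComponent W.sha 2) * (2 : ℚ_[2]) ^ (padicValNat 2 W.tamagawaProduct) *
              (Nat.card (AddCommGroup.primaryComponent
                ((integralModelInt W).map (Int.castRingHom (ZMod 2))).toAffine.Point 2) : ℚ_[2]) ^ 2)
    (hD : Disegni2020.padicBSD_goodOrd_rankOne)
    (hGZK : rank_eq_analyticRank_of_analyticRank_le_one) (hmod : nonempty_modularParametrizationData)
    (hMT : mazurTate_sigmaSq_existsUnique_two) :
    Summit.BirchSwinnertonDyer.BirchSwinnertonDyer.Theses.AlignedTransportAtTwo.BSDOfMainConjectureRankOneAtTwo :=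
  bsdOfMainConjectureRankOneAtTwo_of_leadingTermFormulaAtTwo_of_disegni
    (schneiderLeadingTermFormulaAtTwoSq_iff_eulerChar.mpr hχ) hD hGZK hmod hMT

/-! ## §4 Per cell curve: the VALUE of `χ(Γ, Sel_{2^∞}(E/ℚ_∞))` ⟺ `BSD(W,2)` -/

/-- **TIGHTNESS in the Euler-characteristic currency (CONDITIONAL; closes nothing).** For `W` globally minimal, good ordinary at `2`, analytic
rank one, simple zero of `L₂(f_E)` at `T = 0`, `MazurMainConjecture W 2` — the binders of the crux — and modulo Disegni 2020 Thm. 1 (`hD`),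
Gross–Zagier–Kolyvagin (`hGZK`), modularity (`hmod`), Mazur–Tate `Σ²` at `2` (`hMT`): the VALUE statement for THIS `W` — for every cyclotomic
datum, every finitely generated torsion strict-at-`∞` dual `X`, THE `Σ²` height `Dh`, given `Reg₂(Dh) ≠ 0` and `Ш(2)` finite,
`#coker φ_X·(log₂ 5)^r·#E(ℚ)(2)² = u·#ker φ_X·Reg₂(Dh)·#Ш(2)·2^{v₂(∏c_v)}·#Ẽ(𝔽₂)(2)²` (`u ∈ ℤ₂ˣ`; finiteness of `ker φ_X` is NOT assumed — it is
§2's theorem on the cell) — holds IF AND ONLY IF `BSDp W 2`. So the Euler-characteristic residual of C3′, read curve by curve on the cell, is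
exactly as strong as the crux's conclusion (no counterexample without a failure of `BSD(E,2)`; no strictly weaker per-curve input closes C3′).
[cite: CoatesSchneiderSujatha2003, p. 204 (Case 2)] [cite: Disegni2020, Thm. 1] [cite: Miller2011LMS, Def. 1.1] -/
theorem eulerCharValueAt_iff_bsdp (hD : Disegni2020.padicBSD_goodOrd_rankOne)
    (hGZK : rank_eq_analyticRank_of_analyticRank_le_one) (hmod : nonempty_modularParametrizationData)
    (hMT : mazurTate_sigmaSq_existsUnique_two)
    (W : WeierstrassCurve ℚ) [W.IsElliptic] [W.IsGloballyMinimal] (hord : IsOrdinaryAt W 2) (hr : W.analyticRank = 1)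
    (hL : ∀ [NeZero (W.conductorNorm ℤ)] (f : CuspForm (Gamma0 (W.conductorNorm ℤ)) 2), IsNewformOf W f →
      (padicLFunction f (unitRoot W 2 : ℚ_[2])).order = 1)
    (hMC : MazurMainConjecture W 2) :
    (∀ (κ : ZpExtension ℚ 2) (γ : Field.absoluteGaloisGroup ℚ),
        κ.IsCyclotomic → κ.IsTopGenerator γ → IsCyclotomicVariable 2 γ →
      ∀ (D : W.SelmerDualData κ γ) [Module.Finite (IwasawaAlgebra 2) D.X], D.IsTorsion →
      ∀ (Dh : PAdicHeightData W 2), Dh.IsCanonicalSq →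
        SchneiderConjecture Dh → Finite (AddCommGroup.primaryComponent W.sha 2) →
        ∃ u : ℤ_[2]ˣ,
          (Nat.card (coinvariants 2 D.X ⧸ LinearMap.range (bockstein 2 D.X)) : ℚ_[2]) *
              padicLog 2 (cyclotomicGenerator 2) ^ W.mordellWeilRank *
              (Nat.card (AddCommGroup.primaryComponent W.toAffine.Point 2) : ℚ_[2]) ^ 2 =
            ((u : ℤ_[2]) : ℚ_[2]) * Nat.card (LinearMap.ker (bockstein 2 D.X)) * padicRegulator Dh *
              Nat.card (AddCommGroup.primaryComponent W.sha 2) * (2 : ℚ_[2]) ^ (padicValNat 2 W.tamagawaProduct) *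
              (Nat.card (AddCommGroup.primaryComponent
                ((integralModelInt W).map (Int.castRingHom (ZMod 2))).toAffine.Point 2) : ℚ_[2]) ^ 2) ↔
    BSDp W 2 := by
  have htight := leadingTermFormulaAtTwoAt_iff_bsdp hD hGZK hmod hMT W hord hr hL hMC
  have hiff := schneiderLeadingTermFormulaAtTwoSqAt_iff_eulerCharAt W
  constructor
  · intro hval
    refine htight.mp fun κ γ hκ hγ hγ' D _ hX fE hchar Dh hDh hS hSha ↦ ?_
    have hfin := (finite_bockstein_of_cell hGZK hmod W hord hr hL hMC hκ hγ hγ' D).2.2.1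
    exact (formula_of_eulerChar W hord hκ hγ D hX fE hchar Dh hSha hfin
      (hval κ γ hκ hγ hγ' D hX Dh hDh hS hSha)).2
  · intro hB κ γ hκ hγ hγ' D _ hX Dh hDh hS hSha
    have hF := htight.mpr hB
    have hAt : SchneiderLeadingTermFormulaAtTwoSqAt W := fun _ _ ↦ hF
    exact ((hiff.mp hAt) hord.1 hord.2 κ γ hκ hγ hγ' D hX Dh hDh hS hSha).2

end Summit.BirchSwinnertonDyer.BirchSwinnertonDyer.Theorems.AlignedTransportAtTwoEulerCharAtTwoCell

end
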